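import Summits.CriticalPhenomena.PercolationContinuityZ3.Theorems.PercNearOneGluingNoHeavyLowerTailSeqExchangeThree
import HarnessLib

/-!
# `NoHeavyLowerTail` (stmt-CriticalPhenomena-4575) — the two-pair DECISION-LIST lemma
# ("switching lemma with two switched pairs")

Support file (hull-port / coupling seat `prim-hp-1` gen 10; `--supports stmt-CriticalPhenomena-4575`).
No definitions, no named facts, no sorries.

* `SeqExchange.decisionList_two` — pairs `e₁ = s(v₁,u₁)`, `e₂ = s(v₂,u₂)`, ANY third vertex `v₃`, and `a` with
  `μ(a ↔ b) ≤ μ(v_i ↔ b) + δ_i` (`i = 1,2,3`, `δ₁ ≥ 0`):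
  `μ(a) ≤ μ(v₁; e₁) + μ(v₂; ē₁ e₂) + μ(v₃; ē₁ ē₂) + max δ₁ (max δ₂ δ₃)`
  — `a` is dominated by the decision-list anchor "`v₁` if `e₁` is open, else `v₂` if `e₂` is open, else `v₃`".
  `v₃ = a` is `SeqExchange.seq_two`; one pair (`v₂ = v₃`) is `SeqExchange.switching`.  Proof: the switching lemma for
  `e₂` in the graph `w[e₁ ↦ 0]`, whose domination gaps are paid by the slack of Lemma 3(i) for `e₁`
  (`SeqExchange.gap_after_delete`).
* `SeqExchange.double_deletion_deficit` — the `δ = 0` corollary in deficit form: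
  `μ(a; ē₁ē₂) − μ(v₃; ē₁ē₂) ≤ [μ(v₁;e₁) − μ(a;e₁)] + [μ(v₂;ē₁e₂) − μ(a;ē₁e₂)]`
  ("after deleting two dangerous pairs the deficit of `a` against any anchor is paid by the first pair's slack plus
  the second pair's slack in the deleted graph" — the chain behind the sharp inequality S3♯ of memo §51(a)).
[cite: KozmaNitzan2024, Lemma 3(i) (pp. 6–7), Lemma 5 (p. 13); this work (memo HULLPORT-COUPLING.md §50(b), §51(a))]
-/

namespace Summit.CriticalPhenomena.PercolationContinuityZ3.Theorems

open MeasureTheory Set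
open Literature.Probability.LatticeModels
open Literature.Probability.Percolation

noncomputable section
open Classical

namespace SeqExchange

variable {n : ℕ}

/-- **Two-pair decision list.**  For non-loop pairs `e₁ = s(v₁,u₁)`, `e₂ = s(v₂,u₂)`, any vertex `v₃`, and `a` with
`μ(a ↔ b) ≤ μ(v_i ↔ b) + δ_i` (`δ₁ ≥ 0`):
`μ(a ↔ b) ≤ μ(v₁ ↔ b, e₁ open) + μ(v₂ ↔ b, e₁ closed, e₂ open) + μ(v₃ ↔ b, e₁ closed, e₂ closed) + max δ₁ (max δ₂ δ₃)`.
[cite: KozmaNitzan2024, Lemma 3(i) (pp. 6–7), Lemma 5 (p. 13); this work (memo HULLPORT-COUPLING.md §51)] -/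
theorem decisionList_two (w : Sym2 (Fin n) → unitInterval) (a v₁ u₁ v₂ u₂ v₃ b : Fin n) (h₁ne : v₁ ≠ u₁)
    (h₂ne : v₂ ≠ u₂) {δ₁ δ₂ δ₃ : ℝ} (hδ₁ : 0 ≤ δ₁)
    (h₁ : (prodBernoulli w).real (openConn a b) ≤ (prodBernoulli w).real (openConn v₁ b) + δ₁)
    (h₂ : (prodBernoulli w).real (openConn a b) ≤ (prodBernoulli w).real (openConn v₂ b) + δ₂)
    (h₃ : (prodBernoulli w).real (openConn a b) ≤ (prodBernoulli w).real (openConn v₃ b) + δ₃) :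
    (prodBernoulli w).real (openConn a b) ≤
      (prodBernoulli w).real (openConn v₁ b ∩ {ω | s(v₁, u₁) ∈ ω}) +
        (prodBernoulli w).real (openConn v₂ b ∩ {ω | s(v₁, u₁) ∉ ω} ∩ {ω | s(v₂, u₂) ∈ ω}) +
          (prodBernoulli w).real (openConn v₃ b ∩ {ω | s(v₁, u₁) ∉ ω} ∩ {ω | s(v₂, u₂) ∉ ω}) +
        max δ₁ (max δ₂ δ₃) := by
  set μ := prodBernoulli w with hμ
  set e₁ : Sym2 (Fin n) := s(v₁, u₁) with he₁
  set e₂ : Sym2 (Fin n) := s(v₂, u₂) with he₂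
  set w₀ : Sym2 (Fin n) → unitInterval := Function.update w e₁ 0 with hw₀
  set μ₀ := prodBernoulli w₀ with hμ₀
  set M : ℝ := max δ₁ (max δ₂ δ₃) with hM
  have hm₁ : δ₁ ≤ M := le_max_left _ _
  have hm₂ : δ₂ ≤ M := (le_max_left _ _).trans (le_max_right _ _)
  have hm₃ : δ₃ ≤ M := (le_max_right _ _).trans (le_max_right _ _)
  have hρ0 : 0 ≤ (w e₁ : ℝ) := (w e₁).2.1
  have hρ1 : (w e₁ : ℝ) ≤ 1 := (w e₁).2.2
  -- step 1: Lemma 3(i) for `e₁`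
  have step1 := lemma3i_pair w a v₁ u₁ b h₁ne hδ₁ h₁
  rw [real_setOf_mem] at step1
  set s₁ : ℝ := μ.real (openConn v₁ b ∩ {ω | e₁ ∈ ω}) - μ.real (openConn a b ∩ {ω | e₁ ∈ ω}) with hs₁
  have hsM : 0 ≤ s₁ + M := by
    have : 0 ≤ δ₁ * (w e₁ : ℝ) := mul_nonneg hδ₁ hρ0
    have : δ₁ * (w e₁ : ℝ) ≤ δ₁ := by nlinarith
    rw [hs₁]; linarith
  -- the gaps in `w₀`
  have hgap₂ : (1 - (w e₁ : ℝ)) * (μ₀.real (openConn a b) - μ₀.real (openConn v₂ b)) ≤ s₁ + M := by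
    have := gap_after_delete w a v₁ u₁ v₂ b h₁ne h₁ h₂
    have hmm : max δ₁ δ₂ ≤ M := max_le hm₁ hm₂
    rw [hs₁]; linarith
  have hgap₃ : (1 - (w e₁ : ℝ)) * (μ₀.real (openConn a b) - μ₀.real (openConn v₃ b)) ≤ s₁ + M := by
    have := gap_after_delete w a v₁ u₁ v₃ b h₁ne h₁ h₃
    have hmm : max δ₁ δ₃ ≤ M := max_le hm₁ hm₃
    rw [hs₁]; linarith
  -- slacks in `w₀`
  set δ₂' : ℝ := max 0 (μ₀.real (openConn a b) - μ₀.real (openConn v₂ b)) with hδ₂'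
  set δ₃' : ℝ := max 0 (μ₀.real (openConn a b) - μ₀.real (openConn v₃ b)) with hδ₃'
  have hδ₂'h : μ₀.real (openConn a b) ≤ μ₀.real (openConn v₂ b) + δ₂' := by
    have := le_max_right 0 (μ₀.real (openConn a b) - μ₀.real (openConn v₂ b))
    rw [← hδ₂'] at this; linarith
  have hδ₃'h : μ₀.real (openConn a b) ≤ μ₀.real (openConn v₃ b) + δ₃' := by
    have := le_max_right 0 (μ₀.real (openConn a b) - μ₀.real (openConn v₃ b))
    rw [← hδ₃'] at this; linarith
  have hmax' : (1 - (w e₁ : ℝ)) * max δ₂' δ₃' ≤ s₁ + M := by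
    have h2 : (1 - (w e₁ : ℝ)) * δ₂' ≤ s₁ + M := by
      rcases le_total 0 (μ₀.real (openConn a b) - μ₀.real (openConn v₂ b)) with hpos | hneg
      · rw [hδ₂', max_eq_right hpos]; exact hgap₂
      · rw [hδ₂', max_eq_left hneg, mul_zero]; exact hsM
    have h3 : (1 - (w e₁ : ℝ)) * δ₃' ≤ s₁ + M := by
      rcases le_total 0 (μ₀.real (openConn a b) - μ₀.real (openConn v₃ b)) with hpos | hneg
      · rw [hδ₃', max_eq_right hpos]; exact hgap₃
      · rw [hδ₃', max_eq_left hneg, mul_zero]; exact hsM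
    rcases le_total δ₂' δ₃' with h23 | h32
    · rw [max_eq_right h23]; exact h3
    · rw [max_eq_left h32]; exact h2
  -- step 2: the switching lemma for `e₂` in `w₀`
  have step2 := switching w₀ a v₂ u₂ v₃ b h₂ne hδ₂'h hδ₃'h
  -- closed-side factorisations along `e₁`
  have hsplit_a := real_eq_inter_mem_add_inter_notMem w e₁ (openConn a b)
  have hcl_a : μ.real (openConn a b ∩ {ω | e₁ ∉ ω}) = (1 - (w e₁ : ℝ)) * μ₀.real (openConn a b) :=
    goodStepEI_real_inter_closed_eq w e₁ _
  have hV2 : μ.real (openConn v₂ b ∩ {ω | e₁ ∉ ω} ∩ {ω | e₂ ∈ ω}) =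
      (1 - (w e₁ : ℝ)) * μ₀.real (openConn v₂ b ∩ {ω | e₂ ∈ ω}) := real_inter_notMem_inter w e₁ _ _
  have hV3 : μ.real (openConn v₃ b ∩ {ω | e₁ ∉ ω} ∩ {ω | e₂ ∉ ω}) =
      (1 - (w e₁ : ℝ)) * μ₀.real (openConn v₃ b ∩ {ω | e₂ ∉ ω}) := real_inter_notMem_inter w e₁ _ _
  -- assemble
  have hmain : μ.real (openConn a b ∩ {ω | e₁ ∉ ω}) ≤
      μ.real (openConn v₂ b ∩ {ω | e₁ ∉ ω} ∩ {ω | e₂ ∈ ω}) +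
        μ.real (openConn v₃ b ∩ {ω | e₁ ∉ ω} ∩ {ω | e₂ ∉ ω}) + (s₁ + M) := by
    rw [hcl_a, hV2, hV3]
    have h1' : (1 - (w e₁ : ℝ)) * μ₀.real (openConn a b) ≤
        (1 - (w e₁ : ℝ)) * (μ₀.real (openConn v₂ b ∩ {ω | e₂ ∈ ω}) +
          μ₀.real (openConn v₃ b ∩ {ω | e₂ ∉ ω}) + max δ₂' δ₃') :=
      mul_le_mul_of_nonneg_left step2 (by linarith)
    nlinarith [h1', hmax']
  have hfirst : μ.real (openConn a b ∩ {ω | e₁ ∈ ω}) = μ.real (openConn v₁ b ∩ {ω | e₁ ∈ ω}) - s₁ := by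
    rw [hs₁]; ring
  linarith [hmain, hfirst, hsplit_a]

/-- **Double-deletion deficit.**  With `a ≤ v₁, v₂, v₃` exactly (no slack):
`μ(a; ē₁ē₂) − μ(v₃; ē₁ē₂) ≤ [μ(v₁; e₁) − μ(a; e₁)] + [μ(v₂; ē₁e₂) − μ(a; ē₁e₂)]`,
the deficit of `a` against `v₃` after deleting both pairs is paid by the slack of the first pair plus the slack of
the second pair in the graph with the first deleted.
[cite: KozmaNitzan2024, Lemma 3(i), Lemma 5; this work (memo §51(a), S3♯)] -/
theorem double_deletion_deficit (w : Sym2 (Fin n) → unitInterval) (a v₁ u₁ v₂ u₂ v₃ b : Fin n)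
    (h₁ne : v₁ ≠ u₁) (h₂ne : v₂ ≠ u₂)
    (h₁ : (prodBernoulli w).real (openConn a b) ≤ (prodBernoulli w).real (openConn v₁ b))
    (h₂ : (prodBernoulli w).real (openConn a b) ≤ (prodBernoulli w).real (openConn v₂ b))
    (h₃ : (prodBernoulli w).real (openConn a b) ≤ (prodBernoulli w).real (openConn v₃ b)) :
    (prodBernoulli w).real (openConn a b ∩ {ω | s(v₁, u₁) ∉ ω} ∩ {ω | s(v₂, u₂) ∉ ω}) -
        (prodBernoulli w).real (openConn v₃ b ∩ {ω | s(v₁, u₁) ∉ ω} ∩ {ω | s(v₂, u₂) ∉ ω}) ≤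
      ((prodBernoulli w).real (openConn v₁ b ∩ {ω | s(v₁, u₁) ∈ ω}) -
          (prodBernoulli w).real (openConn a b ∩ {ω | s(v₁, u₁) ∈ ω})) +
        ((prodBernoulli w).real (openConn v₂ b ∩ {ω | s(v₁, u₁) ∉ ω} ∩ {ω | s(v₂, u₂) ∈ ω}) -
          (prodBernoulli w).real (openConn a b ∩ {ω | s(v₁, u₁) ∉ ω} ∩ {ω | s(v₂, u₂) ∈ ω})) := by
  have key := decisionList_two w a v₁ u₁ v₂ u₂ v₃ b h₁ne h₂ne (δ₁ := 0) (δ₂ := 0) (δ₃ := 0) le_rfl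
    (by rw [add_zero]; exact h₁) (by rw [add_zero]; exact h₂) (by rw [add_zero]; exact h₃)
  have hmax : max (0 : ℝ) (max 0 0) = 0 := by simp
  rw [hmax, add_zero] at key
  -- split `μ(a)` along `e₁`, then the closed part along `e₂`
  have hsplit₁ := real_eq_inter_mem_add_inter_notMem w s(v₁, u₁) (openConn a b)
  have hsplit₂ := real_eq_inter_mem_add_inter_notMem w s(v₂, u₂) (openConn a b ∩ {ω | s(v₁, u₁) ∉ ω})
  linarith [hsplit₁, hsplit₂]

end SeqExchange

end

end Summit.CriticalPhenomena.PercolationContinuityZ3.Theorems
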